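import Summits.QuantumFields.YangMills.Theorems.BalabanLadderROTUVExtract
import Summits.QuantumFields.YangMills.Theorems.Y2BridgeClay
import HarnessLib

/-!
# Crux `ROT` (stmt-QuantumFields-20042): the King side — the upgrade under Theorems, the limit-point form of KING, and `ROT` closed modulo the King input

Helper file (`--supports stmt-QuantumFields-20042`) of the fleet lead `ym-spine-20042-p1`, line of record «King split»
(skeleton v3 `Cruxes/ROT/Lines/birth.lean`, ff3050db3a1215f0; vocabulary `Theorems/BalabanLadderROTDefs.lean`; the UV half
`stub_uvExtract : UVExtract` is PROVED in `Theorems/BalabanLadderROTUVExtract.lean`).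

* `latticeRotWard_of_uvCompactAt_of_latticeKingWard` — **the King upgrade** (seat ym-beyond-p4 g14's `kingUpgrade`,
  refereed PASS, re-homed VERBATIM from the skeleton's Cruxes-only namespace `YMBeyond.P4.ROT`): UV sequential
  compactness off the diagonal at `(G, r, a)` + vanishing finite-angle lattice rotation defects on a set of angles `Θ`
  generating a DENSE additive subgroup of `ℝ` ⇒ the infinitesimal rotation-Ward defect vanishes along every admissible
  scheme (`LatticeRotWard G r a`).  Mechanism of C. King, Commun. Math. Phys. 103 (1986) 323–349, Thm 2.4: along a
  convergent subsequence the limit `S₁` is invariant on King's class at every `θ ∈ Θ` (uniqueness of limits), hence —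
  orbit functions of a density-bounded functional being continuous (tree `King.germInvariant_planeRot_of_king`) — under
  every rotation of the `(x₀,x₁)`-plane on the germ; the orbit of `F` is then constant and differentiable at `0` with
  derivative `S₁ n D` (tree `GermWard.hasDerivAt_orbit_zero`), so `S₁ n D = 0`, and the lattice defects converge to it;
  `tendsto_of_subseq_tendsto` removes the subsequence.
* **The limit-point form of KING** (the lead's reading of `stub_king`, kernel-checked): under `UVCompactAt r a` the
  lattice statement `LatticeKingWard G r a Θ` (finite-angle defects `→ 0` along the scheme, `∃ r₀` per scheme) is
  EQUIVALENT to «every off-diagonal limit point `S₁` along every subsequence of the scheme is `R_θ`-invariant on King's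
  class `KingClass n r₀`, `θ ∈ Θ`» (`limitsKingInvariant_of_latticeKingWard`: uniqueness of limits, no compactness;
  `latticeKingWard_of_uvCompactAt_of_limitsKingInvariant`: a defect not tending to `0` has a subsequence bounded away
  from `0`, which has a convergent sub-subsequence — contradiction).  So, GIVEN the crux's own UV guard `MomentBounds6`
  (⇒ `UVCompactAt`, proved), the registered `stub_king : KingAll` may be replaced by the WEAKER, UV-CONSUMING statement
  that the UV limit points of lattice Yang–Mills in hyperscaling units are King-invariant on the germ — E1 of the limit
  points at the Pythagorean angles, nothing about uncalibrated units (owner's call; `rot_of_kingLimit` is the closing form).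
* `rot_of_kingLimit` — **the crux from King-invariance of UV limit points** (hypothesis spelled out, no new definition):
  `(∀ G r a, a > 0 → a → 0 → MomentBounds6 G r a → limit points King-invariant at the Pythagorean angles) → ROT`.
* `rot_of_kingAll` — **the crux modulo the registered `stub_king`**: `KingAll → Theses.BalabanLadder.ROT` (the skeleton's
  `ROT_of` with `stub_uvExtract` discharged; the `LowerBounds` guard of `ROT` is not used).  CONDITIONAL on `KingAll`.

No definition, no named fact, no sorry; standard axioms.  NOT a proof of E1: the rotation leg is REDUCED to the King input.
-/

set_option autoImplicit false

noncomputable section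

open scoped SchwartzMap
open MeasureTheory Filter Topology
open Literature.MathematicalPhysics.QuantumFieldTheory Literature.MathematicalPhysics.QuantumLattice
open Literature.MathematicalPhysics.AQFT Literature.Probability.LatticeModels
open Summit.QuantumFields.YangMills.Cruxes.OSLegsFromFemtoAndGap.DlrCollarTransfer
open Summit.QuantumFields.YangMills.Cruxes.OSLegsAtWeakCouplingC.Sketch
open Summit.QuantumFields.YangMills.Cruxes.OSLegsAtWeakCouplingC.Y2Bridge
open Summit.QuantumFields.YangMills.Theorems.OSLegsFromFemtoAndGap (latticeDist)
open Summit.QuantumFields.YangMills.Theorems.OSLegsFromFemtoAndGap.Upgrade (isOffDiagonal_linActMulti)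
open Summit.QuantumFields.YangMills.Theorems.NPointIsotropy.Negative (E4)

namespace Summit.QuantumFields.YangMills.Theorems.ROT

section KingSide

variable {G : Type} [Group G] [TopologicalSpace G] [IsTopologicalGroup G] [CompactSpace G]
  [MeasurableSpace G] [BorelSpace G]

/-! ## The King upgrade -/

/-- **The King upgrade** (p4's `kingUpgrade`, re-homed): UV sequential compactness off the diagonal plus vanishing
finite-angle lattice rotation defects on a set of angles `Θ` whose additive closure is dense give the infinitesimal
lattice rotation-Ward identity `LatticeRotWard G r a` along EVERY admissible scheme.  [C. King, Commun. Math. Phys. 103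
(1986), Thm 2.4 — mechanism; tree `King.germInvariant_planeRot_of_king`, `GermWard.hasDerivAt_orbit_zero`] -/
theorem latticeRotWard_of_uvCompactAt_of_latticeKingWard (r : LatticeRep G) (a : ℝ → ℝ) (hX : UVCompactAt r a)
    (Θ : Set ℝ) (hΘ : Dense ((AddSubgroup.closure Θ : AddSubgroup ℝ) : Set ℝ))
    (hK : LatticeKingWard G r a Θ) : LatticeRotWard G r a := by
  -- adapted verbatim from `YMBeyond.P4.ROT.kingUpgrade` (Cruxes/ROT/Lines/birth.lean, seat ym-beyond-p4 g14)
  intro sch hunits hβ hranges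
  obtain ⟨r₀, hr₀, hKs⟩ := hK sch hunits hβ hranges
  refine ⟨r₀, hr₀, fun n hn F D hF hFc hδ hFr hD => ?_⟩
  obtain ⟨δ, hδ, hFδ⟩ := hδ
  have hDoff : IsOffDiagonal D :=
    GermWard.isOffDiagonal_of_tsupport_subset_separated hδ ((tsupport_rotDeriv_subset F D hD).trans hFδ)
  refine tendsto_of_subseq_tendsto fun ns hns => ?_
  obtain ⟨ψ, hψ, S₁, h1, hdens, hconv⟩ := hX sch ⟨hunits, hβ, hranges⟩ ns hns
  refine ⟨ψ, ?_⟩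
  have hsub : Tendsto (ns ∘ ψ) atTop atTop := hns.comp hψ.tendsto_atTop
  -- King invariance of the limit on the class, by uniqueness of limits along the subsequence
  have hKing : ∀ (m : ℕ), 2 ≤ m → ∀ F' ∈ King.KingClass m r₀, ∀ θ ∈ Θ,
      S₁ m (linActMulti (planeRot (0 : Fin 3) θ) F') = S₁ m F' := by
    intro m hm F' hF' θ hθ
    have hdiff := (hKs m hm F' hF' θ hθ).comp hsub
    have h₁ := hconv m hm (linActMulti (planeRot (0 : Fin 3) θ) F') (isOffDiagonal_linActMulti _ hF'.1)
    have h₂ := hconv m hm F' hF'.1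
    exact sub_eq_zero.1 (tendsto_nhds_unique (h₁.sub h₂) hdiff)
  -- germ invariance under every rotation of the (x₀,x₁)-plane (King's density argument, tree)
  have hgerm : ∀ φ : ℝ, GermInvariant S₁ (planeRot (0 : Fin 3) φ) r₀ :=
    King.germInvariant_planeRot_of_king S₁ hdens h1 hΘ hKing
  -- the orbit of `F` is constant and differentiable at `0` with derivative `S₁ n D`; hence `S₁ n D = 0`
  obtain ⟨B, hB⟩ := hdens n δ hδ
  have horbit : HasDerivAt (fun θ : ℝ => S₁ n (linActMulti (planeRot (0 : Fin 3) θ) F)) (S₁ n D) 0 :=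
    GermWard.hasDerivAt_orbit_zero S₁ hB F D hFc hFδ hD
  have hconst : (fun θ : ℝ => S₁ n (linActMulti (planeRot (0 : Fin 3) θ) F)) = fun _ => S₁ n F :=
    funext fun θ => hgerm θ n F hF hFr
  rw [hconst] at horbit
  have hD0 : S₁ n D = 0 := horbit.unique (hasDerivAt_const (0 : ℝ) (S₁ n F))
  -- convergence along the subsequence to `S₁ n D = 0`
  have hlim := hconv n hn D hDoff
  rw [hD0] at hlim
  simpa [Function.comp] using hlim

/-! ## KING in limit-point form -/

/-- **Lattice KING ⇒ King-invariance of every off-diagonal limit point** (no compactness needed): if the finite-angle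
defects tend to `0` along the scheme, then every limit `S₁` of the centred lattice distributions along any subsequence
`φ → ∞` satisfies `S₁ n (R_θ · F) = S₁ n F` on King's class, `θ ∈ Θ` (uniqueness of limits). [folklore; C. King,
CMP 103 (1986) Thm 2.4 — mechanism] -/
theorem limitsKingInvariant_of_latticeKingWard (r : LatticeRep G) (a : ℝ → ℝ) (Θ : Set ℝ)
    (hK : LatticeKingWard G r a Θ) (sch : SpeciesScheme (YMSpecies G)) (hsch : IsLegScheme a sch) :
    ∃ r₀ : ℝ, 0 < r₀ ∧ ∀ φ : ℕ → ℕ, Tendsto φ atTop atTop → ∀ S₁ : SchwingerFamily E4,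
      OffDiagLimitAlong r sch φ S₁ → ∀ (n : ℕ), 2 ≤ n → ∀ F ∈ King.KingClass n r₀, ∀ θ ∈ Θ,
        S₁ n (linActMulti (planeRot (0 : Fin 3) θ) F) = S₁ n F := by
  obtain ⟨hunits, hβ, hranges⟩ := hsch
  obtain ⟨r₀, hr₀, hKs⟩ := hK sch hunits hβ hranges
  refine ⟨r₀, hr₀, fun φ hφ S₁ hS₁ n hn F hF θ hθ => ?_⟩
  obtain ⟨-, -, hconv⟩ := hS₁
  have hdiff := (hKs n hn F hF θ hθ).comp hφ
  have h₁ := hconv n hn (linActMulti (planeRot (0 : Fin 3) θ) F) (isOffDiagonal_linActMulti _ hF.1)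
  have h₂ := hconv n hn F hF.1
  exact sub_eq_zero.1 (tendsto_nhds_unique (h₁.sub h₂) hdiff)

/-- **King-invariance of every off-diagonal limit point ⇒ lattice KING, under UV compactness**: if at `(G, r, a)` every
subsequence of every admissible scheme has a further subsequence with an off-diagonal limit (`UVCompactAt r a`), and
every such limit is `R_θ`-invariant on `KingClass n r₀` (`r₀` depending on the scheme only), then the finite-angle
lattice defects tend to `0` along the scheme (`LatticeKingWard G r a Θ`): a sequence each of whose subsequences has a
sub-subsequence along which it tends to `0` tends to `0`. [folklore] -/
theorem latticeKingWard_of_uvCompactAt_of_limitsKingInvariant (r : LatticeRep G) (a : ℝ → ℝ)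
    (hX : UVCompactAt r a) (Θ : Set ℝ)
    (hlim : ∀ sch : SpeciesScheme (YMSpecies G), IsLegScheme a sch → ∃ r₀ : ℝ, 0 < r₀ ∧
      ∀ φ : ℕ → ℕ, Tendsto φ atTop atTop → ∀ S₁ : SchwingerFamily E4, OffDiagLimitAlong r sch φ S₁ →
        ∀ (n : ℕ), 2 ≤ n → ∀ F ∈ King.KingClass n r₀, ∀ θ ∈ Θ,
          S₁ n (linActMulti (planeRot (0 : Fin 3) θ) F) = S₁ n F) :
    LatticeKingWard G r a Θ := by
  intro sch hunits hβ hranges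
  obtain ⟨r₀, hr₀, H⟩ := hlim sch ⟨hunits, hβ, hranges⟩
  refine ⟨r₀, hr₀, fun n hn F hF θ hθ => ?_⟩
  refine tendsto_of_subseq_tendsto fun ns hns => ?_
  obtain ⟨ψ, hψ, S₁, hS₁⟩ := hX sch ⟨hunits, hβ, hranges⟩ ns hns
  refine ⟨ψ, ?_⟩
  have hsub : Tendsto (ns ∘ ψ) atTop atTop := hns.comp hψ.tendsto_atTop
  have hinv := H (ns ∘ ψ) hsub S₁ hS₁ n hn F hF θ hθ
  obtain ⟨-, -, hconv⟩ := hS₁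
  have h₁ := hconv n hn (linActMulti (planeRot (0 : Fin 3) θ) F) (isOffDiagonal_linActMulti _ hF.1)
  have h₂ := hconv n hn F hF.1
  have h := h₁.sub h₂
  rw [hinv, sub_self] at h
  simpa [Function.comp] using h

end KingSide

/-! ## The crux from the King input -/

/-- **`ROT` from King-invariance of the UV limit points** (the UV-consuming, limit-point form of the King input; its
hypothesis is spelled out, no definition): if for every compact simple `G`, every `r`, every positive unit map `a → 0`
carrying `MomentBounds6 G r a`, every off-diagonal limit point along every subsequence of every admissible scheme is
invariant under the rotations of the `(x₀,x₁)`-plane by the Pythagorean angles on King's class (some `r₀ > 0` per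
scheme), then the route's crux `Theses.BalabanLadder.ROT` holds — by `stub_uvExtract` (compactness),
`latticeKingWard_of_uvCompactAt_of_limitsKingInvariant` and the King upgrade at the dense subgroup of Pythagorean angles.
The `LowerBounds` guard of `ROT` is not used. [C. King, CMP 103 (1986) Thm 2.4 — mechanism] -/
theorem rot_of_kingLimit
    (hKL : ∀ (G : Type) [Group G] [TopologicalSpace G] [IsTopologicalGroup G] [CompactSpace G],
      IsCompactSimpleLieGroup G → letI : MeasurableSpace G := borel G; haveI : BorelSpace G := ⟨rfl⟩;
      ∀ (r : LatticeRep G) (a : ℝ → ℝ), (∀ β, 0 < a β) → Tendsto a atTop (𝓝 0) → MomentBounds6 G r a →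
        ∀ sch : SpeciesScheme (YMSpecies G), IsLegScheme a sch → ∃ r₀ : ℝ, 0 < r₀ ∧
          ∀ φ : ℕ → ℕ, Tendsto φ atTop atTop → ∀ S₁ : SchwingerFamily E4, OffDiagLimitAlong r sch φ S₁ →
            ∀ (n : ℕ), 2 ≤ n → ∀ F ∈ King.KingClass n r₀, ∀ θ ∈ (King.pythagoreanAngles : Set ℝ),
              S₁ n (linActMulti (planeRot (0 : Fin 3) θ) F) = S₁ n F) :
    Summit.QuantumFields.YangMills.Theses.BalabanLadder.ROT := by
  intro G _ _ _ _ hG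
  letI : MeasurableSpace G := borel G
  haveI : BorelSpace G := ⟨rfl⟩
  intro r a ha ha0 _ hUV
  have hX : UVCompactAt r a := stub_uvExtract G hG r a ha ha0 hUV
  exact latticeRotWard_of_uvCompactAt_of_latticeKingWard r a hX _ King.dense_closure_pythagoreanAngles
    (latticeKingWard_of_uvCompactAt_of_limitsKingInvariant r a hX _ (hKL G hG r a ha ha0 hUV))

/-- **`ROT` modulo the registered stub `stub_king`**: the un-guarded King statement `KingAll` implies the route's crux
`Summit.QuantumFields.YangMills.Theses.BalabanLadder.ROT` — the King upgrade at the Pythagorean angles (dense closure),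
with the UV compactness supplied by the PROVED `stub_uvExtract` from the crux's own hypothesis `MomentBounds6 G r a`;
the `LowerBounds` guard of `ROT` is not used.  CONDITIONAL on `KingAll` (hypothesis). [C. King, CMP 103 (1986) Thm 2.4] -/
theorem rot_of_kingAll (hK : KingAll) : Summit.QuantumFields.YangMills.Theses.BalabanLadder.ROT := by
  intro G _ _ _ _ hG
  letI : MeasurableSpace G := borel G
  haveI : BorelSpace G := ⟨rfl⟩
  intro r a ha ha0 _ hUV
  exact latticeRotWard_of_uvCompactAt_of_latticeKingWard r a (stub_uvExtract G hG r a ha ha0 hUV) _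
    King.dense_closure_pythagoreanAngles (hK G hG r a ha ha0)

end Summit.QuantumFields.YangMills.Theorems.ROT

end
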